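import Summits.BirchSwinnertonDyer.BirchSwinnertonDyer.Theorems.PrintCf2SplitBadTwoAvatarValuesTwo
import HarnessLib

/-!
# The `v`-adic embedding `𝓞_K → ℤ₂` read through `ι : ℚ̄₂ ≃ ℂ`, and the reduction `𝓞_K → ℤ/2ⁿ`
# (crux `stmt-BirchSwinnertonDyer-23721` `PrintCf2RubinValueTwo.RubinValueFormulaAtTwo`, line
# `value-transport`, stub B18s `stub_frameSeed_two` — file 1 of the seed supply)

Cell `bsd-print-cf2`, seat `cruxlead-23721` g3.  Theses-free; `--supports` the crux; no definitions
(everything is stated for an arbitrary ring map `φ₀ : 𝓞 K →+* ℤ₂` detecting the place `v`, whose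
existence from the frame's embedding datum is `exists_intEmb`).  The seed supply (de Shalit II.4.17
(54): a Hecke character `η` with `θK⁻¹η` unramified at `v`, through the `ℤ₂²`-tower) needs ARITHMETIC at
the split place `v ∣ 2` of the frame field `K ∋ √−7`, read through the frame's `ι : ℚ̄₂ ≃+* ℂ` pinned
to `v` (`k ∈ 𝔭_v ↔ ‖ι⁻¹(σ(k))‖ < 1`).  THIS FILE:

* §1 **`exists_intEmb`**: for `[K:ℚ] = 2`, `√−7 ∈ K` and any ring map `φ : K → ℚ̄₂` there is
  `φ₀ : 𝓞 K →+* ℤ₂` with `φ₀ k = φ k` in `ℚ̄₂` (`φ` lands in `ℚ₂`, `QuadraticPart.ring…_two`; algebraic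
  integers of `ℚ̄₂` have norm `≤ 1`); under the place condition, `k ∈ 𝔭_v ↔ 2 ∣ φ₀ k`.
* §2 for ANY `φ₀ : 𝓞 K →+* ℤ₂` with `k ∈ 𝔭_v ↔ 2 ∣ φ₀ k`: units off `𝔭_v`; `𝔭_vⁿ ↦ 2ⁿℤ₂`; and, when
  `ord_v 2 = 1` (the split unramified case), **`mem_pow_iff_pow_dvd`**: `k ∈ 𝔭_vⁿ ↔ 2ⁿ ∣ φ₀ k` (induction
  on `n` in the Dedekind domain `𝓞 K`, `Ideal.eq_prime_pow_of_succ_lt_of_le`); hence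
  `toZModPow n (φ₀ a) = toZModPow n (φ₀ b) ↔ a ≡ b mod 𝔭_vⁿ`, and the reduction is onto `ℤ/2ⁿ`.

HONEST FRAMING: elementary plumbing (no class field theory); closes nothing by itself; beyond-print
theorem: no.  BSD is not proved by any of this.

References: [SerreAbelianLadic1968] Ch. II §2.7 (the embedding datum); [NeukirchANT1999] Ch. I §3,
Ch. II §3; [deShalit1987] II.4.17 (54).
-/

-- the summit namespace `Summit.BirchSwinnertonDyer.BirchSwinnertonDyer` repeats the problem name by design (D-0017)
set_option linter.dupNamespace false
set_option autoImplicit false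

noncomputable section

open scoped Classical

open NumberField IsDedekindDomain Literature.NumberTheory.GaloisRepresentations
  Literature.NumberTheory.EllipticCurves

namespace Summit.BirchSwinnertonDyer.BirchSwinnertonDyer.Theorems.PrintCf2.FrameSeed

variable {K : Type} [Field K] [NumberField K]

/-! ## §1 The embedding `𝓞 K → ℤ₂` from a ring map `K → ℚ̄₂` -/

section Embedding

/-- Algebraic integers of `ℚ̄_p` have norm at most one (the valuation ring of `ℚ̄_p` is integrally
closed and contains `ℤ`). [cite: SerreAbelianLadic1968, Ch. II §2.7] -/
private theorem norm_le_one_of_isIntegral {p : ℕ} [Fact p.Prime] {x : PadicAlgCl p}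
    (hx : IsIntegral ℤ x) : ‖x‖ ≤ 1 := by
  have hv := Valuation.integer.integers (Valued.v (R := PadicAlgCl p))
  have hx' : IsIntegral (Valued.v (R := PadicAlgCl p)).integer x := hx.tower_top
  have h := (hv.isIntegral_iff_v_le_one).mp hx'
  rw [PadicAlgCl.valuation_def] at h
  exact_mod_cast h

/-- **The `v`-adic embedding `𝓞 K →+* ℤ₂` behind a ring map `φ : K → ℚ̄₂`** of a quadratic field
`K ∋ √−7`: `φ` takes values in `ℚ₂` (`−7` is a `2`-adic square) and integers go to integers, so there is
`φ₀ : 𝓞 K →+* ℤ₂` with `φ₀ k = φ k` in `ℚ̄₂` for every `k ∈ 𝓞 K`.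
[cite: Serre1973, Ch. II §3.3 Thm. 4] [cite: SerreAbelianLadic1968, Ch. II §2.7] -/
theorem exists_intEmb (hK2 : Module.finrank ℚ K = 2) {θ : K} (hθ : θ ^ 2 = -7) (φ : K →+* PadicAlgCl 2) :
    ∃ φ₀ : 𝓞 K →+* ℤ_[2], ∀ k : 𝓞 K,
      algebraMap ℚ_[2] (PadicAlgCl 2) ((φ₀ k : ℤ_[2]) : ℚ_[2]) = φ (k : K) := by
  have hmem := QuadraticPart.ringHom_apply_mem_range_algebraMap_two hK2 hθ φ
  choose q hq using hmem
  have hinj : Function.Injective (algebraMap ℚ_[2] (PadicAlgCl 2)) :=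
    (algebraMap ℚ_[2] (PadicAlgCl 2)).injective
  -- `q` is a ring map `K → ℚ₂`
  have hq1 : q 1 = 1 := hinj (by rw [hq, map_one, map_one])
  have hq0 : q 0 = 0 := hinj (by rw [hq, map_zero, map_zero])
  have hqm : ∀ x y, q (x * y) = q x * q y := fun x y ↦ hinj (by rw [hq, map_mul, map_mul, hq, hq])
  have hqa : ∀ x y, q (x + y) = q x + q y := fun x y ↦ hinj (by rw [hq, map_add, map_add, hq, hq])
  -- integers have norm `≤ 1`
  have hnorm : ∀ k : 𝓞 K, ‖q (k : K)‖ ≤ 1 := fun k ↦ by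
    rw [← PadicAlgCl.norm_extends, hq]
    exact norm_le_one_of_isIntegral ((RingOfIntegers.isIntegral_coe k).map (φ.toIntAlgHom))
  let φ₀ : 𝓞 K →+* ℤ_[2] :=
    { toFun := fun k ↦ ⟨q (k : K), hnorm k⟩
      map_one' := PadicInt.ext (by simp [hq1])
      map_mul' := fun x y ↦ PadicInt.ext (by simp [hqm])
      map_zero' := PadicInt.ext (by simp [hq0])
      map_add' := fun x y ↦ PadicInt.ext (by simp [hqa]) }
  exact ⟨φ₀, fun k ↦ hq (k : K)⟩

omit [NumberField K] in
/-- **The place condition transported**: if `k ∈ 𝔭_v ↔ ‖φ k‖ < 1` (the frame's pinning of `ι` to `v`)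
and `φ₀ k = φ k` in `ℚ̄₂`, then `k ∈ 𝔭_v ↔ 2 ∣ φ₀ k`. [cite: SerreAbelianLadic1968, Ch. II §2.7] -/
theorem mem_iff_two_dvd_of_norm {φ : K →+* PadicAlgCl 2} {φ₀ : 𝓞 K →+* ℤ_[2]}
    (hφ₀ : ∀ k : 𝓞 K, algebraMap ℚ_[2] (PadicAlgCl 2) ((φ₀ k : ℤ_[2]) : ℚ_[2]) = φ (k : K))
    {v : HeightOneSpectrum (𝓞 K)} (hφv : ∀ k : 𝓞 K, k ∈ v.asIdeal ↔ ‖φ (k : K)‖ < 1) (k : 𝓞 K) :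
    k ∈ v.asIdeal ↔ (2 : ℤ_[2]) ∣ φ₀ k := by
  rw [hφv k, ← hφ₀ k, PadicAlgCl.norm_extends, ← PadicInt.norm_def]
  exact_mod_cast PadicInt.norm_lt_one_iff_dvd (φ₀ k)

end Embedding

/-! ## §2 A ring map `𝓞 K → ℤ₂` detecting `v`: units, powers of `𝔭_v`, reduction modulo `2ⁿ` -/

section Detect

variable {v : HeightOneSpectrum (𝓞 K)} {φ₀ : 𝓞 K →+* ℤ_[2]}

omit [NumberField K] in
/-- `2ⁿ ∣ φ₀ k ↔ toZModPow n (φ₀ k) = 0`. [folklore] -/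
theorem toZModPow_eq_zero_iff (n : ℕ) (k : 𝓞 K) :
    PadicInt.toZModPow n (φ₀ k) = 0 ↔ (2 : ℤ_[2]) ^ n ∣ φ₀ k := by
  rw [← RingHom.mem_ker, PadicInt.ker_toZModPow, Ideal.mem_span_singleton, Nat.cast_ofNat]

omit [NumberField K] in
/-- The reduction `𝓞 K → ℤ/2ⁿ` is onto (every ring map to `ℤ/m` is). [folklore] -/
theorem toZModPow_comp_surjective (n : ℕ) :
    Function.Surjective ((PadicInt.toZModPow n).comp φ₀) := ZMod.ringHom_surjective _

/-- `2 ∈ 𝔭_v` when `ord_v 2 = 1`. [folklore] -/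
theorem two_mem_of_intValuation (h2v : v.intValuation (2 : 𝓞 K) = WithZero.exp (-1 : ℤ)) :
    (2 : 𝓞 K) ∈ v.asIdeal := by
  rw [← HeightOneSpectrum.intValuation_lt_one_iff_mem, h2v, ← WithZero.exp_zero, WithZero.exp_lt_exp]
  norm_num

variable (hv : ∀ k : 𝓞 K, k ∈ v.asIdeal ↔ (2 : ℤ_[2]) ∣ φ₀ k)
include hv

omit [NumberField K] in
/-- **`k ∉ 𝔭_v ↔ φ₀ k ∈ ℤ₂ˣ`.** [cite: SerreAbelianLadic1968, Ch. II §2.7] -/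
theorem not_mem_iff_isUnit (k : 𝓞 K) : k ∉ v.asIdeal ↔ IsUnit (φ₀ k) := by
  have h := PadicInt.norm_lt_one_iff_dvd (φ₀ k)
  rw [Nat.cast_ofNat] at h
  rw [hv k, ← h, PadicInt.isUnit_iff, not_lt]
  exact ⟨fun h' ↦ le_antisymm (PadicInt.norm_le_one _) h', fun h' ↦ h'.ge⟩

omit [NumberField K] in
/-- A unit off `𝔭_v` reduces to a unit of `ℤ/2ⁿ`. [folklore] -/
theorem isUnit_toZModPow_of_not_mem (n : ℕ) {k : 𝓞 K} (hk : k ∉ v.asIdeal) :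
    IsUnit (PadicInt.toZModPow n (φ₀ k)) :=
  ((not_mem_iff_isUnit hv k).mp hk).map _

omit [NumberField K] in
/-- `𝔭_v` is the pull-back of `(2) ⊆ ℤ₂`. [cite: SerreAbelianLadic1968, Ch. II §2.7] -/
theorem asIdeal_eq_comap_span_two : v.asIdeal = (Ideal.span {(2 : ℤ_[2])}).comap φ₀ := by
  ext k
  rw [Ideal.mem_comap, Ideal.mem_span_singleton]
  exact hv k

omit [NumberField K] in
/-- **`𝔭_vⁿ ↦ 2ⁿ ℤ₂`**: `k ∈ 𝔭_vⁿ ⟹ 2ⁿ ∣ φ₀ k`. [cite: NeukirchANT1999, Ch. I §3] -/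
theorem pow_dvd_of_mem_pow {n : ℕ} {k : 𝓞 K} (hk : k ∈ v.asIdeal ^ n) : (2 : ℤ_[2]) ^ n ∣ φ₀ k := by
  have h := Ideal.le_comap_pow φ₀ (K := Ideal.span {(2 : ℤ_[2])}) n
  rw [← asIdeal_eq_comap_span_two hv, Ideal.span_singleton_pow] at h
  exact Ideal.mem_span_singleton.mp (h hk)

variable (h2v : v.intValuation (2 : 𝓞 K) = WithZero.exp (-1 : ℤ))
include h2v

/-- **`2ⁿ ∣ φ₀ k ⟹ k ∈ 𝔭_vⁿ` at an unramified `v`** (`ord_v 2 = 1`): by induction on `n` — if `k ∈ 𝔭_vⁿ ∖ 𝔭_v^{n+1}`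
then `(k) + 𝔭_v^{n+1} = 𝔭_vⁿ ∋ 2ⁿ` (no ideal lies strictly between consecutive powers of a prime of a
Dedekind domain), so `2ⁿ = a k + b` with `b ∈ 𝔭_v^{n+1}`, and `2^{n+1} ∣ φ₀ k, φ₀ b` would give
`2^{n+1} ∣ 2ⁿ` in `ℤ₂`. [cite: NeukirchANT1999, Ch. I §3] -/
theorem mem_pow_of_pow_dvd : ∀ (n : ℕ) (k : 𝓞 K), (2 : ℤ_[2]) ^ n ∣ φ₀ k → k ∈ v.asIdeal ^ n := by
  intro n
  induction n with
  | zero => intro k _; rw [pow_zero, Ideal.one_eq_top]; exact Submodule.mem_top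
  | succ n ih =>
    intro k hk
    have hk' : k ∈ v.asIdeal ^ n := ih k (dvd_trans (pow_dvd_pow _ n.le_succ) hk)
    by_contra hkn
    -- `(k) + 𝔭^{n+1} = 𝔭^n`
    set I : Ideal (𝓞 K) := Ideal.span {k} ⊔ v.asIdeal ^ (n + 1) with hI
    have hle : I ≤ v.asIdeal ^ n :=
      sup_le ((Ideal.span_singleton_le_iff_mem _).mpr hk') (Ideal.pow_le_pow_right n.le_succ)
    have hlt : v.asIdeal ^ (n + 1) < I := by
      refine lt_of_le_of_ne le_sup_right fun h ↦ hkn ?_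
      rw [h]
      exact le_sup_left (b := v.asIdeal ^ (n + 1)) (Ideal.mem_span_singleton_self k)
    have hIeq : I = v.asIdeal ^ n := Ideal.eq_prime_pow_of_succ_lt_of_le v.ne_bot hlt hle
    -- `2^n ∈ 𝔭^n = I`
    have h2n : (2 : 𝓞 K) ^ n ∈ I := by
      rw [hIeq]
      exact Ideal.pow_mem_pow (two_mem_of_intValuation h2v) n
    rw [hI, Submodule.mem_sup] at h2n
    obtain ⟨x, hx, b, hb, hxb⟩ := h2n
    obtain ⟨a, rfl⟩ := Ideal.mem_span_singleton'.mp hx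
    -- apply `φ₀`: `2^{n+1} ∣ 2^n` in `ℤ₂`
    have hb' : (2 : ℤ_[2]) ^ (n + 1) ∣ φ₀ b := pow_dvd_of_mem_pow hv hb
    have hsum : (2 : ℤ_[2]) ^ (n + 1) ∣ (2 : ℤ_[2]) ^ n := by
      have h : φ₀ (a * k + b) = (2 : ℤ_[2]) ^ n := by rw [hxb, map_pow, map_ofNat]
      rw [← h, map_add, map_mul]
      exact dvd_add (dvd_mul_of_dvd_right hk _) hb'
    -- contradiction in `ℤ₂`
    obtain ⟨c, hc⟩ := hsum
    have h2ne : (2 : ℤ_[2]) ^ n ≠ 0 := pow_ne_zero _ two_ne_zero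
    have hone : (2 : ℤ_[2]) ^ n * 1 = (2 : ℤ_[2]) ^ n * (2 * c) := by
      rw [mul_one, ← mul_assoc, ← pow_succ, ← hc]
    have hunit : IsUnit (2 : ℤ_[2]) := IsUnit.of_mul_eq_one c (mul_left_cancel₀ h2ne hone).symm
    have hlt : ‖(2 : ℤ_[2])‖ < 1 := (PadicInt.norm_lt_one_iff_dvd (2 : ℤ_[2])).mpr ⟨1, by simp⟩
    rw [PadicInt.isUnit_iff] at hunit
    exact absurd hunit hlt.ne

/-- **`k ∈ 𝔭_vⁿ ↔ 2ⁿ ∣ φ₀ k`.** [cite: NeukirchANT1999, Ch. I §3 and Ch. II §3] -/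
theorem mem_pow_iff_pow_dvd (n : ℕ) (k : 𝓞 K) : k ∈ v.asIdeal ^ n ↔ (2 : ℤ_[2]) ^ n ∣ φ₀ k :=
  ⟨pow_dvd_of_mem_pow hv, mem_pow_of_pow_dvd hv h2v n k⟩

/-- `ker ((ℤ₂ → ℤ/2ⁿ) ∘ φ₀) = 𝔭_vⁿ`. [cite: NeukirchANT1999, Ch. II §3] -/
theorem ker_toZModPow_comp_eq_pow (n : ℕ) : RingHom.ker ((PadicInt.toZModPow n).comp φ₀) = v.asIdeal ^ n := by
  ext k
  rw [RingHom.mem_ker, RingHom.comp_apply, toZModPow_eq_zero_iff, mem_pow_iff_pow_dvd hv h2v]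

/-- **Two integers have the same reduction modulo `2ⁿ` iff they are congruent modulo `𝔭_vⁿ`.**
[cite: NeukirchANT1999, Ch. II §3] -/
theorem toZModPow_eq_iff_sub_mem_pow (n : ℕ) (a b : 𝓞 K) :
    PadicInt.toZModPow n (φ₀ a) = PadicInt.toZModPow n (φ₀ b) ↔ a - b ∈ v.asIdeal ^ n := by
  rw [← ker_toZModPow_comp_eq_pow hv h2v n, RingHom.mem_ker, map_sub, sub_eq_zero, RingHom.comp_apply,
    RingHom.comp_apply]

/-- The valuation form: `toZModPow n (φ₀ a) = toZModPow n (φ₀ b)` iff `|a − b|_v ≤ |ϖ|^n`.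
[cite: NeukirchANT1999, Ch. II §3] -/
theorem toZModPow_eq_iff_intValuation_le (n : ℕ) (a b : 𝓞 K) :
    PadicInt.toZModPow n (φ₀ a) = PadicInt.toZModPow n (φ₀ b) ↔
      v.intValuation (a - b) ≤ WithZero.exp (-(n : ℤ)) := by
  rw [toZModPow_eq_iff_sub_mem_pow hv h2v, HeightOneSpectrum.intValuation_le_pow_iff_mem]

end Detect

end Summit.BirchSwinnertonDyer.BirchSwinnertonDyer.Theorems.PrintCf2.FrameSeed

end
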